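import Summits.CriticalPhenomena.PercolationContinuityZ3.Theorems.PercNearOneGluingNoHeavyLowerTailThreePointProductFormLeakDefs
import Summits.CriticalPhenomena.PercolationContinuityZ3.Theorems.PercNearOneGluingNoHeavyLowerTailThreePointProductFormLeakCert1
import Summits.CriticalPhenomena.PercolationContinuityZ3.Theorems.PercNearOneGluingNoHeavyLowerTailThreePointProductFormLeakCert2
import Summits.CriticalPhenomena.PercolationContinuityZ3.Theorems.PercNearOneGluingNoHeavyLowerTailThreePointProductFormLeakCert3
import Summits.CriticalPhenomena.PercolationContinuityZ3.Theorems.PercNearOneGluingNoHeavyLowerTailThreePointProductFormLeakCert4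
import Summits.CriticalPhenomena.PercolationContinuityZ3.Theorems.PercNearOneGluingNoHeavyLowerTailThreePointProductFormLeakCert5

/-!
# LEMMA Λ (the leak lemma) for the one-child boundary-star cycle: `Λ ≤ −(7/30)·t` for EVERY physical word
# (Sahi programme, box problem, prover prim-sahi-p2 gen 66)

Support file (`--supports stmt-CriticalPhenomena-4575`).  Standard axioms, no sorries, no named facts.  Memo
`run/shared/lean/prim/prim-sahi/FROM-prim-sahi-p2-gen66-KREIN-STRUCTURE.md` §4–§5b, `prim-sahi-p2/PROOF-E3.md` §76.

THE STATEMENT.  For the 12-state normal form of the AM-form series `A = #P1 + #P2 − 2·#bad` (`…ProductFormABPlus`) driven by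
PHYSICAL letters `(s,d)` (`0 ≤ s ± d`; the child `(u,w) = ((s+d)/2,(s−d)/2)` of the cycle vertex), the leak coordinate
`Λ = ℓ₀ + (28/3)e₁′ + 7e₂′` (`…ProductFormKrein.Lam`) satisfies `Λ + (7/30)·t ≤ 0` on every state reached from `ω` by a NONEMPTY word
(`leak_le`).  Equivalently `0 ≤ G` for the quotient coordinate `G = −Λ − (7/30)t` of `…ProductFormLeakDefs`.  This is lemma (i) of the
three-lemma reduction of the box theorem (memo §4): in the pair identity `A[u++w] = (81/64)tt' − (135/112)(tΛ'+Λt') − …` it makes the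
`Λ`-terms nonnegative.

THE PROOF.  The rational cone `K_ℚ = inK` (10 linear + 2 quadratic constraints, memo §5b) contains the one-letter states (`inK_first`) and is
mapped into itself by every physical letter (`inK_Astep`): the twelve constraint-preservation facts are the exact S-procedure certificates
`cert_*` of `…ProductFormLeakCert1–5` (found by semidefinite programming with facial reduction and rounded exactly; kit j344062–j344070;
independent exact verifier `gen66/lab66/lamverify.py`), the quadratic constraint `Q2` on four regions of `G/(ã + τ/20)`; `L2` is elementary and
`L8 = (0 ≤ G)` follows from `Q2`.  Induction over the word (`inK_brun`).  [this work] (gen 66).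
-/

namespace Summit.CriticalPhenomena.PercolationContinuityZ3.Theorems.ProductFormABPlus

/-- From a certificate `0 ≤ s²·P·L` with `s ≠ 0`, `P > 0` conclude `0 ≤ L`. [this work] -/
theorem nonneg_of_cert {s P L : ℚ} (hs : s ≠ 0) (hP : 0 < P) (h : 0 ≤ s ^ 2 * P * L) : 0 ≤ L := by
  have hs2 : 0 < s ^ 2 := lt_of_le_of_ne (sq_nonneg s) (Ne.symm (pow_ne_zero 2 hs))
  by_contra hL
  push Not at hL
  have : s ^ 2 * P * L < 0 := mul_neg_of_pos_of_neg (mul_pos hs2 hP) hL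
  linarith

set_option maxHeartbeats 2000000 in
/-- ★ INVARIANCE: every physical letter maps the leak cone `K_ℚ` into itself. [this work] -/
theorem inK_Astep (s d : ℚ) (z : Z5) (hp : 0 ≤ s + d) (hm : 0 ≤ s - d) (h : inK z) : inK (Astep s d z) := by
  obtain ⟨h1, h2, h3, h4, h5, h6p, h6m, h7p, h7m, h8, hQ1, hQ2⟩ := h
  rcases eq_or_ne s 0 with hs0 | hs
  · -- s = 0 forces d = 0 and the image is the zero state
    have hd : d = 0 := by subst hs0; linarith
    subst hs0; subst hd
    unfold inK Astep
    norm_num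
  have hPnn : 0 ≤ ((1:ℚ)*z.τ + (1:ℚ)*z.v₁ + ((23:ℚ)/8)*z.v₂) := by linarith
  rcases eq_or_lt_of_le hPnn with hP0 | hPpos
  · -- degenerate face τ = v₁ = v₂ = η = 0: the image is (0,0,0,0,χ G)
    have ht : z.τ = 0 := by linarith
    have hv2 : z.v₂ = 0 := by linarith
    have hv1 : z.v₁ = 0 := by linarith
    have he : z.η = 0 := by linarith
    unfold inK Astep
    simp only [ht, hv1, hv2, he]
    have h8' : 0 ≤ z.G := by linarith
    have hG1 := mul_nonneg (sq_nonneg s) h8'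
    have hG2 := mul_nonneg (sq_nonneg d) h8'
    refine ⟨?_, ?_, ?_, ?_, ?_, ?_, ?_, ?_, ?_, ?_, ?_, ?_⟩ <;>
      first | (norm_num; done) | nlinarith [hG1, hG2, h8']
  -- generic case: the certificates
  have hs2 : 0 < s ^ 2 := lt_of_le_of_ne (sq_nonneg s) (Ne.symm (pow_ne_zero 2 hs))
  have cL1 := cert_L1 s d z.τ z.v₁ z.v₂ z.η z.G hp hm h1 h2 h3 h4 h5 h6p h6m h7p h7m h8 hQ1 hQ2
  have cL3 := cert_L3 s d z.τ z.v₁ z.v₂ z.η z.G hp hm h1 h2 h3 h4 h5 h6p h6m h7p h7m h8 hQ1 hQ2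
  have cL4 := cert_L4 s d z.τ z.v₁ z.v₂ z.η z.G hp hm h1 h2 h3 h4 h5 h6p h6m h7p h7m h8 hQ1 hQ2
  have cL5 := cert_L5 s d z.τ z.v₁ z.v₂ z.η z.G hp hm h1 h2 h3 h4 h5 h6p h6m h7p h7m h8 hQ1 hQ2
  have cL6p := cert_L6p s d z.τ z.v₁ z.v₂ z.η z.G hp hm h1 h2 h3 h4 h5 h6p h6m h7p h7m h8 hQ1 hQ2
  have cL6m := cert_L6m s d z.τ z.v₁ z.v₂ z.η z.G hp hm h1 h2 h3 h4 h5 h6p h6m h7p h7m h8 hQ1 hQ2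
  have cL7p := cert_L7p s d z.τ z.v₁ z.v₂ z.η z.G hp hm h1 h2 h3 h4 h5 h6p h6m h7p h7m h8 hQ1 hQ2
  have cL7m := cert_L7m s d z.τ z.v₁ z.v₂ z.η z.G hp hm h1 h2 h3 h4 h5 h6p h6m h7p h7m h8 hQ1 hQ2
  have cQ1 := cert_Q1 s d z.τ z.v₁ z.v₂ z.η z.G hp hm h1 h2 h3 h4 h5 h6p h6m h7p h7m h8 hQ1 hQ2
  -- Q2: four regions of G relative to (4/5, 3/2, 13/5)·(ã + τ/20)
  have cQ2 : 0 ≤ ((-25:ℚ)*(s^2*(((5:ℚ)/4)*z.η) + (s*d)*(((-3:ℚ)/80)*z.τ + ((-3:ℚ)/4)*z.v₁ + ((-37:ℚ)/16)*z.v₂) + d^2*(((1:ℚ)/4)*z.η))*(s^2*(((5:ℚ)/4)*z.η) + (s*d)*(((-3:ℚ)/80)*z.τ + ((-3:ℚ)/4)*z.v₁ + ((-37:ℚ)/16)*z.v₂) + d^2*(((1:ℚ)/4)*z.η)) + ((23:ℚ)/4)*(s^2*(((3:ℚ)/160)*z.τ + (1:ℚ)*z.v₁ + ((15:ℚ)/4)*z.v₂)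 + d^2*(((-3:ℚ)/160)*z.τ))*(s^2*(((7:ℚ)/40)*z.τ + ((3:ℚ)/4)*z.G) + (s*d)*(((-28:ℚ)/3)*z.η) + d^2*(((7:ℚ)/24)*z.τ + ((14:ℚ)/9)*z.v₁ + ((161:ℚ)/18)*z.v₂ + ((1:ℚ)/4)*z.G)) + (2:ℚ)*(s^2*(((3:ℚ)/640)*z.τ + ((-5:ℚ)/2)*z.v₂) + (s*d)*((-1:ℚ)*z.η) + d^2*(((9:ℚ)/128)*z.τ + ((3:ℚ)/4)*z.v₁ + ((37:ℚ)/16)*z.v₂))*(s^2*(((7:ℚ)/40)*z.τ + ((3:ℚ)/4)*z.G) + (s*d)*(((-28:ℚ)/3)*z.η) + d^2*(((7:ℚ)/24)*z.τ + ((14:ℚ)/9)*z.v₁ + ((161:ℚ)/18)*z.v₂ + ((1:ℚ)/4)*z.G)) + ((7:ℚ)/10)*(s^2*(((3:ℚ)/4)*z.τ) + d^2*(((1:ℚ)/4)*z.τ))*(s^2*(((7:ℚ)/40)*z.τ + ((3:ℚ)/4)*z.G) + (s*d)*(((-28:ℚ)/3)*z.η) + d^2*(((7:ℚ)/24)*z.τ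 + ((14:ℚ)/9)*z.v₁ + ((161:ℚ)/18)*z.v₂ + ((1:ℚ)/4)*z.G))) := by
    rcases le_total 0 (((1:ℚ)/25)*z.τ + ((4:ℚ)/5)*z.v₁ + ((23:ℚ)/10)*z.v₂ + (-1:ℚ)*z.G) with hr0 | hr0'
    · exact cert_Q2_g0up s d z.τ z.v₁ z.v₂ z.η z.G hp hm h1 h2 h3 h4 h5 h6p h6m h7p h7m h8 hr0 hQ1 hQ2
    · have hg1lo : 0 ≤ (((-1:ℚ)/25)*z.τ + ((-4:ℚ)/5)*z.v₁ + ((-23:ℚ)/10)*z.v₂ + (1:ℚ)*z.G) := by linarith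
      rcases le_total 0 (((3:ℚ)/40)*z.τ + ((3:ℚ)/2)*z.v₁ + ((69:ℚ)/16)*z.v₂ + (-1:ℚ)*z.G) with hr1 | hr1'
      · exact cert_Q2_g1lo_g1up s d z.τ z.v₁ z.v₂ z.η z.G hp hm h1 h2 h3 h4 h5 h6p h6m h7p h7m h8 hg1lo hr1 hQ1 hQ2
      · have hg2lo : 0 ≤ (((-3:ℚ)/40)*z.τ + ((-3:ℚ)/2)*z.v₁ + ((-69:ℚ)/16)*z.v₂ + (1:ℚ)*z.G) := by linarith
        rcases le_total 0 (((13:ℚ)/100)*z.τ + ((13:ℚ)/5)*z.v₁ + ((299:ℚ)/40)*z.v₂ + (-1:ℚ)*z.G) with hr2 | hr2'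
        · exact cert_Q2_g2lo_g2up s d z.τ z.v₁ z.v₂ z.η z.G hp hm h1 h2 h3 h4 h5 h6p h6m h7p h7m h8 hg2lo hr2 hQ1 hQ2
        · have hg3lo : 0 ≤ (((-13:ℚ)/100)*z.τ + ((-13:ℚ)/5)*z.v₁ + ((-299:ℚ)/40)*z.v₂ + (1:ℚ)*z.G) := by linarith
          exact cert_Q2_g3lo s d z.τ z.v₁ z.v₂ z.η z.G hp hm h1 h2 h3 h4 h5 h6p h6m h7p h7m h8 hg3lo hQ1 hQ2
  -- the linear constraints of the image
  have dL1 : 0 ≤ ((1:ℚ)*(s^2*(((3:ℚ)/4)*z.τ) + d^2*(((1:ℚ)/4)*z.τ))) := nonneg_of_cert hs hPpos cL1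
  have dL2 : 0 ≤ ((1:ℚ)*(s^2*(((3:ℚ)/160)*z.τ + (1:ℚ)*z.v₁ + ((15:ℚ)/4)*z.v₂) + d^2*(((-3:ℚ)/160)*z.τ))) := by
    nlinarith [mul_nonneg (sq_nonneg s) h3, mul_nonneg (sq_nonneg s) h2, mul_nonneg (mul_nonneg hp hm) h1]
  have dL3 : 0 ≤ ((1:ℚ)*(s^2*(((3:ℚ)/640)*z.τ + ((-5:ℚ)/2)*z.v₂) + (s*d)*((-1:ℚ)*z.η) + d^2*(((9:ℚ)/128)*z.τ + ((3:ℚ)/4)*z.v₁ + ((37:ℚ)/16)*z.v₂)) + ((7:ℚ)/8)*(s^2*(((3:ℚ)/160)*z.τ + (1:ℚ)*z.v₁ + ((15:ℚ)/4)*z.v₂) + d^2*(((-3:ℚ)/160)*z.τ))) := nonneg_of_cert hs hPpos cL3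
  have dL4 : 0 ≤ (((1:ℚ)/10)*(s^2*(((3:ℚ)/4)*z.τ) + d^2*(((1:ℚ)/4)*z.τ)) + ((-14:ℚ)/25)*(s^2*(((3:ℚ)/640)*z.τ + ((-5:ℚ)/2)*z.v₂) + (s*d)*((-1:ℚ)*z.η) + d^2*(((9:ℚ)/128)*z.τ + ((3:ℚ)/4)*z.v₁ + ((37:ℚ)/16)*z.v₂)) + ((39:ℚ)/100)*(s^2*(((3:ℚ)/160)*z.τ + (1:ℚ)*z.v₁ + ((15:ℚ)/4)*z.v₂) + d^2*(((-3:ℚ)/160)*z.τ))) := nonneg_of_cert hs hPpos cL4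
  have dL5 : 0 ≤ (((3:ℚ)/100)*(s^2*(((3:ℚ)/4)*z.τ) + d^2*(((1:ℚ)/4)*z.τ)) + ((-19:ℚ)/50)*(s^2*(((3:ℚ)/640)*z.τ + ((-5:ℚ)/2)*z.v₂) + (s*d)*((-1:ℚ)*z.η) + d^2*(((9:ℚ)/128)*z.τ + ((3:ℚ)/4)*z.v₁ + ((37:ℚ)/16)*z.v₂)) + ((363:ℚ)/400)*(s^2*(((3:ℚ)/160)*z.τ + (1:ℚ)*z.v₁ + ((15:ℚ)/4)*z.v₂) + d^2*(((-3:ℚ)/160)*z.τ))) := nonneg_of_cert hs hPpos cL5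
  have dL6p : 0 ≤ (((1:ℚ)/50)*(s^2*(((3:ℚ)/4)*z.τ) + d^2*(((1:ℚ)/4)*z.τ)) + ((1:ℚ)/2)*(s^2*(((3:ℚ)/640)*z.τ + ((-5:ℚ)/2)*z.v₂) + (s*d)*((-1:ℚ)*z.η) + d^2*(((9:ℚ)/128)*z.τ + ((3:ℚ)/4)*z.v₁ + ((37:ℚ)/16)*z.v₂)) + ((23:ℚ)/16)*(s^2*(((3:ℚ)/160)*z.τ + (1:ℚ)*z.v₁ + ((15:ℚ)/4)*z.v₂) + d^2*(((-3:ℚ)/160)*z.τ)) + (-1:ℚ)*(s^2*(((5:ℚ)/4)*z.η) + (s*d)*(((-3:ℚ)/80)*z.τ + ((-3:ℚ)/4)*z.v₁ + ((-37:ℚ)/16)*z.v₂) + d^2*(((1:ℚ)/4)*z.η))) := nonneg_of_cert hs hPpos cL6p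
  have dL6m : 0 ≤ (((1:ℚ)/50)*(s^2*(((3:ℚ)/4)*z.τ) + d^2*(((1:ℚ)/4)*z.τ)) + ((1:ℚ)/2)*(s^2*(((3:ℚ)/640)*z.τ + ((-5:ℚ)/2)*z.v₂) + (s*d)*((-1:ℚ)*z.η) + d^2*(((9:ℚ)/128)*z.τ + ((3:ℚ)/4)*z.v₁ + ((37:ℚ)/16)*z.v₂)) + ((23:ℚ)/16)*(s^2*(((3:ℚ)/160)*z.τ + (1:ℚ)*z.v₁ + ((15:ℚ)/4)*z.v₂) + d^2*(((-3:ℚ)/160)*z.τ)) + (1:ℚ)*(s^2*(((5:ℚ)/4)*z.η) + (s*d)*(((-3:ℚ)/80)*z.τ + ((-3:ℚ)/4)*z.v₁ + ((-37:ℚ)/16)*z.v₂) + d^2*(((1:ℚ)/4)*z.η))) := nonneg_of_cert hs hPpos cL6m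
  have dL7p : 0 ≤ (((3:ℚ)/5)*(s^2*(((3:ℚ)/640)*z.τ + ((-5:ℚ)/2)*z.v₂) + (s*d)*((-1:ℚ)*z.η) + d^2*(((9:ℚ)/128)*z.τ + ((3:ℚ)/4)*z.v₁ + ((37:ℚ)/16)*z.v₂)) + ((37:ℚ)/40)*(s^2*(((3:ℚ)/160)*z.τ + (1:ℚ)*z.v₁ + ((15:ℚ)/4)*z.v₂) + d^2*(((-3:ℚ)/160)*z.τ)) + (-1:ℚ)*(s^2*(((5:ℚ)/4)*z.η) + (s*d)*(((-3:ℚ)/80)*z.τ + ((-3:ℚ)/4)*z.v₁ + ((-37:ℚ)/16)*z.v₂) + d^2*(((1:ℚ)/4)*z.η))) := nonneg_of_cert hs hPpos cL7p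
  have dL7m : 0 ≤ (((3:ℚ)/5)*(s^2*(((3:ℚ)/640)*z.τ + ((-5:ℚ)/2)*z.v₂) + (s*d)*((-1:ℚ)*z.η) + d^2*(((9:ℚ)/128)*z.τ + ((3:ℚ)/4)*z.v₁ + ((37:ℚ)/16)*z.v₂)) + ((37:ℚ)/40)*(s^2*(((3:ℚ)/160)*z.τ + (1:ℚ)*z.v₁ + ((15:ℚ)/4)*z.v₂) + d^2*(((-3:ℚ)/160)*z.τ)) + (1:ℚ)*(s^2*(((5:ℚ)/4)*z.η) + (s*d)*(((-3:ℚ)/80)*z.τ + ((-3:ℚ)/4)*z.v₁ + ((-37:ℚ)/16)*z.v₂) + d^2*(((1:ℚ)/4)*z.η))) := nonneg_of_cert hs hPpos cL7m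
  -- L8 (0 ≤ G') from Q2' = 2 G' (ã' + (7/20) τ') − 25 η'² and ã' + (7/20)τ' ≥ 0
  have hA'nn : 0 ≤ ((1:ℚ)*(s^2*(((3:ℚ)/640)*z.τ + ((-5:ℚ)/2)*z.v₂) + (s*d)*((-1:ℚ)*z.η) + d^2*(((9:ℚ)/128)*z.τ + ((3:ℚ)/4)*z.v₁ + ((37:ℚ)/16)*z.v₂)) + ((23:ℚ)/8)*(s^2*(((3:ℚ)/160)*z.τ + (1:ℚ)*z.v₁ + ((15:ℚ)/4)*z.v₂) + d^2*(((-3:ℚ)/160)*z.τ))) + ((7:ℚ)/20)*(s^2*(((3:ℚ)/4)*z.τ) + d^2*(((1:ℚ)/4)*z.τ)) := by linarith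
  have dL8 : 0 ≤ ((1:ℚ)*(s^2*(((7:ℚ)/40)*z.τ + ((3:ℚ)/4)*z.G) + (s*d)*(((-28:ℚ)/3)*z.η) + d^2*(((7:ℚ)/24)*z.τ + ((14:ℚ)/9)*z.v₁ + ((161:ℚ)/18)*z.v₂ + ((1:ℚ)/4)*z.G))) := by
    rcases eq_or_lt_of_le hA'nn with hA0 | hApos
    · -- degenerate: τ' = ã' = 0 forces τ = v₁ = v₂ = η = 0, and then G' = χ·G
      have ht' : (s^2*(((3:ℚ)/4)*z.τ) + d^2*(((1:ℚ)/4)*z.τ)) = 0 := by linarith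
      have hv2' : (s^2*(((3:ℚ)/160)*z.τ + (1:ℚ)*z.v₁ + ((15:ℚ)/4)*z.v₂) + d^2*(((-3:ℚ)/160)*z.τ)) = 0 := by linarith
      have h1' : 0 ≤ z.τ := by linarith
      have ht : z.τ = 0 := by
        by_contra hne
        have hpos : 0 < z.τ := lt_of_le_of_ne h1' (Ne.symm hne)
        have := mul_pos hs2 hpos
        nlinarith [mul_nonneg (sq_nonneg d) h1']
      have hX : s^2 * (z.v₁ + ((15:ℚ)/4)*z.v₂) = 0 := by rw [ht] at hv2'; linear_combination hv2'
      have hv12 : z.v₁ + ((15:ℚ)/4)*z.v₂ = 0 := by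
        rcases mul_eq_zero.mp hX with h0 | h0
        · exact absurd h0 (pow_ne_zero 2 hs)
        · exact h0
      have hv2 : z.v₂ = 0 := by linarith
      have hv1 : z.v₁ = 0 := by linarith
      have he : z.η = 0 := by linarith
      have hG' : (1:ℚ)*(s^2*(((7:ℚ)/40)*z.τ + ((3:ℚ)/4)*z.G) + (s*d)*(((-28:ℚ)/3)*z.η) + d^2*(((7:ℚ)/24)*z.τ + ((14:ℚ)/9)*z.v₁ + ((161:ℚ)/18)*z.v₂ + ((1:ℚ)/4)*z.G)) = (((3:ℚ)/4)*s^2 + ((1:ℚ)/4)*d^2) * z.G := by rw [ht, hv1, hv2, he]; ring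
      rw [hG']
      have h8' : 0 ≤ z.G := by linarith
      positivity
    · by_contra hG
      push Not at hG
      have hneg := mul_neg_of_neg_of_pos hG hApos
      have hsq := sq_nonneg (s^2*(((5:ℚ)/4)*z.η) + (s*d)*(((-3:ℚ)/80)*z.τ + ((-3:ℚ)/4)*z.v₁ + ((-37:ℚ)/16)*z.v₂) + d^2*(((1:ℚ)/4)*z.η))
      linarith [cQ2, hneg, hsq]
  unfold inK
  exact ⟨dL1, dL2, dL3, dL4, dL5, dL6p, dL6m, dL7p, dL7m, dL8, cQ1, cQ2⟩

set_option maxHeartbeats 1000000 in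
/-- The one-letter states are in the cone: `Astep s d (zOf ω) ∈ K_ℚ` for every physical letter. [this work] -/
theorem inK_first (s d : ℚ) (hp : 0 ≤ s + d) (hm : 0 ≤ s - d) : inK (Astep s d (zOf omegaA)) := by
  rw [zOf_omegaA]
  unfold inK Astep
  have hsd : 0 ≤ (s + d) * (s - d) := mul_nonneg hp hm
  refine ⟨?_, ?_, ?_, ?_, ?_, ?_, ?_, ?_, ?_, ?_, ?_, ?_⟩ <;>
    nlinarith [hsd, sq_nonneg s, sq_nonneg d, sq_nonneg (s+d), sq_nonneg (s-d), mul_nonneg (mul_nonneg hp hm) (sq_nonneg d),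
      mul_nonneg (mul_nonneg hp hm) (sq_nonneg s), mul_nonneg hsd hsd, sq_nonneg (s*d), sq_nonneg (s^2 - d^2)]

/-- Every state reached from `ω` by a nonempty physical word lies in `K_ℚ`. [this work] -/
theorem inK_brun : ∀ (w : List (ℚ × ℚ)), (∀ θ ∈ w, 0 ≤ θ.1 + θ.2 ∧ 0 ≤ θ.1 - θ.2) → w ≠ [] →
    inK (zOf (brunA w omegaA))
  | [], _, hne => absurd rfl hne
  | [θ], hw, _ => by
    have h := hw θ (by simp)
    show inK (zOf (bstepA θ.1 θ.2 omegaA))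
    rw [zOf_bstepA]
    exact inK_first θ.1 θ.2 h.1 h.2
  | θ :: θ' :: u, hw, _ => by
    have h := hw θ (by simp)
    have ih := inK_brun (θ' :: u) (fun x hx => hw x (List.mem_cons_of_mem θ hx)) (by simp)
    show inK (zOf (bstepA θ.1 θ.2 (brunA (θ' :: u) omegaA)))
    rw [zOf_bstepA]
    exact inK_Astep θ.1 θ.2 _ h.1 h.2 ih

/-- ★ LEMMA Λ (the leak lemma): for every NONEMPTY word of physical letters `(s,d)` (`0 ≤ s ± d`), the state `v` reached from `ω`
satisfies `Λ(v) + (7/30)·t(v) ≤ 0`, i.e. `ℓ₀ ≤ −(28/3)e₁′ − 7e₂′ − (7/30)t` (memo §4(i)). [this work] -/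
theorem leak_le (w : List (ℚ × ℚ)) (hw : ∀ θ ∈ w, 0 ≤ θ.1 + θ.2 ∧ 0 ≤ θ.1 - θ.2) (hne : w ≠ []) :
    Lam (brunA w omegaA) + (7/30) * (brunA w omegaA).t ≤ 0 := by
  have h := (inK_brun w hw hne).2.2.2.2.2.2.2.2.2.1
  simp only [zOf] at h
  linarith

end Summit.CriticalPhenomena.PercolationContinuityZ3.Theorems.ProductFormABPlus
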